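import Summits.AtomisticToContinuum.BoseEinsteinCondensation.Theorems.BECThomsonPrincipleFibreConductanceFlatteningDefs
import HarnessLib

/-!
# Route `BECThomsonPrinciple`, crux `FibreConductance` (stmt-AtomisticToContinuum-9480),
# line `parseval-shell-bootstrap` (r4) — stub `stub_flatFlowDiv`: WEAK DIVERGENCE OF THE FLATTENING FLOW

`stub_flatFlowDiv : Goal.stub_flatFlowDiv` (`= FlatFlowDiv` of
`Theorems/BECThomsonPrincipleFibreConductanceFlatteningDefs.lean`): for `L > 0` and a zero-free state,
the iterated-primitive flow `flatFlow` has weak `x₀`-divergence `ψ² − L⁻³⟨⟨⟨g⟩⟩⟩` against every `C¹`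
test function periodic in every particle.

* `gDens_periodic`, `gAvg1_periodic`, `gAvg2_periodic` — torus-periodicity of `g = L³ψ²` and of its
  iterated line averages (`fibrePsi_periodic`, `lineAvg_periodic`);
* `integral_linePrim_mul_fderiv` — ONE COMPONENT: if `f` is `C¹`, torus-periodic and has zero line
  integrals along the axis `l` of particle `0`, then `∫_{cellN} (∫₀^{x_{0,l}} f)·∂_{0,l}η = −∫_{cellN} f η`
  (the line primitive is `C¹` and torus-periodic — `contDiff_linePrim`, `linePrim_periodic` —, the
  product with `η` integrates to zero under `∂_{0,l}` — `integral_cellN_fderiv_zero` —, product rule,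
  and `∂_{0,l}` of the primitive is `f` — `fderiv_linePrim_fibreDir`);
* `stub_flatFlowDiv` — the three components (integrands = fluctuations about line averages, which
  have zero line integrals: `intervalIntegral_fluct`) and the telescoping identity
  `L⁻³[(⟨⟨g⟩⟩₁ − ⟨⟨⟨g⟩⟩⟩₀) + (⟨g⟩₂ − ⟨⟨g⟩⟩₁) + (g − ⟨g⟩₂)] = ψ² − L⁻³⟨⟨⟨g⟩⟩⟩`.

All [folklore] (one-variable calculus and periodic integration by parts; Folland, *Real Analysis*,
§2.6).
-/

noncomputable section

namespace Summit.AtomisticToContinuum.BoseEinsteinCondensation.Cruxes.FibreConductance.ParsevalShellBootstrap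

open MeasureTheory
open scoped ENNReal
open Literature.MathematicalPhysics.QuantumManyBody.BoseGas
open Summit.AtomisticToContinuum.BoseEinsteinCondensation.Cruxes.FibreConductance.TaggedPathHarnack

variable {m : ℕ} {L : ℝ}

/-! ### Periodicity of the objects -/

/-- `g` is torus-periodic in every particle and axis. [folklore] -/
theorem gDens_periodic (L : ℝ) (Φ : PeriodicTrialState (m + 1) L) (X : Config (m + 1))
    (i : Fin (m + 1)) (k : Fin 3) :
    gDens L Φ (X + Pi.single i (EuclideanSpace.single k L)) = gDens L Φ X := by
  unfold gDens
  rw [fibrePsi_periodic]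

/-- `⟨g⟩₂` is torus-periodic. [folklore] -/
theorem gAvg1_periodic (L : ℝ) (Φ : PeriodicTrialState (m + 1) L) (X : Config (m + 1))
    (i : Fin (m + 1)) (k : Fin 3) :
    gAvg1 L Φ (X + Pi.single i (EuclideanSpace.single k L)) = gAvg1 L Φ X :=
  lineAvg_periodic L 2 (gDens_periodic L Φ) X i k

/-- `⟨⟨g⟩₂⟩₁` is torus-periodic. [folklore] -/
theorem gAvg2_periodic (L : ℝ) (Φ : PeriodicTrialState (m + 1) L) (X : Config (m + 1))
    (i : Fin (m + 1)) (k : Fin 3) :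
    gAvg2 L Φ (X + Pi.single i (EuclideanSpace.single k L)) = gAvg2 L Φ X :=
  lineAvg_periodic L 1 (gAvg1_periodic L Φ) X i k

/-! ### One component: periodic integration by parts against a line primitive -/

/-- **Integration by parts against a line primitive.** If `f` is `C¹`, torus-periodic and has
vanishing line integrals along the axis `l` of particle `0`, then its line primitive `J = ∫₀^{x_{0,l}} f`
pairs with every `C¹` periodic test function as `∫_{cellN} J ∂_{0,l}η = −∫_{cellN} f η`. [folklore] -/
theorem integral_linePrim_mul_fderiv (hL : 0 < L) (l : Fin 3) {f : Config (m + 1) → ℝ}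
    (hf : ContDiff ℝ 1 f)
    (hfper : ∀ (X : Config (m + 1)) (i : Fin (m + 1)) (k : Fin 3),
      f (X + Pi.single i (EuclideanSpace.single k L)) = f X)
    (havg : ∀ X : Config (m + 1), ∫ t in (0 : ℝ)..L, f (linePt l X t) = 0)
    {η : Config (m + 1) → ℂ} (hη : ContDiff ℝ 1 η)
    (hηper : ∀ (X : Config (m + 1)) (i : Fin (m + 1)) (k : Fin 3),
      η (X + Pi.single i (EuclideanSpace.single k L)) = η X) :
    ∫ X in cellN (m + 1) L, ((linePrim l f X : ℝ) : ℂ) *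
        fderiv ℝ η X (Pi.single 0 (EuclideanSpace.single l 1)) =
      - ∫ X in cellN (m + 1) L, ((f X : ℝ) : ℂ) * η X := by
  have hJ : ContDiff ℝ 1 (linePrim l f) := contDiff_linePrim l hf
  have hJc : ContDiff ℝ 1 (fun X => ((linePrim l f X : ℝ) : ℂ)) := Complex.ofRealCLM.contDiff.comp hJ
  have hJper : ∀ (X : Config (m + 1)) (i : Fin (m + 1)) (k : Fin 3),
      linePrim l f (X + Pi.single i (EuclideanSpace.single k L)) = linePrim l f X :=
    linePrim_periodic l hf.continuous hfper havg
  -- the product `G = J η`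
  have hG : ContDiff ℝ 1 (fun X => ((linePrim l f X : ℝ) : ℂ) * η X) := hJc.mul hη
  have hGper : ∀ (X : Config (m + 1)) (k : Fin 3),
      ((linePrim l f (X + Pi.single (0 : Fin (m + 1)) (EuclideanSpace.single k L)) : ℝ) : ℂ) *
          η (X + Pi.single (0 : Fin (m + 1)) (EuclideanSpace.single k L)) =
        ((linePrim l f X : ℝ) : ℂ) * η X := fun X k => by
    rw [hJper X 0 k, hηper X 0 k]
  have hIBP := integral_cellN_fderiv_zero hL hG hGper l
  -- product rule
  have hderivJ : ∀ X : Config (m + 1),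
      fderiv ℝ (fun X => ((linePrim l f X : ℝ) : ℂ)) X (Pi.single 0 (EuclideanSpace.single l 1)) =
        ((f X : ℝ) : ℂ) := by
    intro X
    have hd : DifferentiableAt ℝ (linePrim l f) X := (hJ.differentiable one_ne_zero) X
    rw [show (fun X => ((linePrim l f X : ℝ) : ℂ)) = Complex.ofRealCLM ∘ linePrim l f from rfl,
      fderiv_comp X Complex.ofRealCLM.differentiableAt hd, ContinuousLinearMap.fderiv,
      ContinuousLinearMap.comp_apply, Complex.ofRealCLM_apply]
    congr 1
    exact fderiv_linePrim_fibreDir l hf X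
  have hprod : ∀ X : Config (m + 1),
      fderiv ℝ (fun X => ((linePrim l f X : ℝ) : ℂ) * η X) X (Pi.single 0 (EuclideanSpace.single l 1)) =
        ((f X : ℝ) : ℂ) * η X +
          ((linePrim l f X : ℝ) : ℂ) * fderiv ℝ η X (Pi.single 0 (EuclideanSpace.single l 1)) := by
    intro X
    have h := (((hJc.differentiable one_ne_zero) X).hasFDerivAt.mul
      ((hη.differentiable one_ne_zero) X).hasFDerivAt).fderiv
    rw [show (fun X => ((linePrim l f X : ℝ) : ℂ) * η X) = (fun X => ((linePrim l f X : ℝ) : ℂ)) * η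
        from rfl, h, _root_.add_apply, FunLike.coe_smul, FunLike.coe_smul,
      Pi.smul_apply, Pi.smul_apply, hderivJ, smul_eq_mul, smul_eq_mul]
    ring
  simp_rw [hprod] at hIBP
  have hi1 : Integrable (fun X => ((f X : ℝ) : ℂ) * η X) (volume.restrict (cellN (m + 1) L)) :=
    integrableOn_cellN ((Complex.continuous_ofReal.comp hf.continuous).mul hη.continuous) L
  have hi2 : Integrable (fun X => ((linePrim l f X : ℝ) : ℂ) *
      fderiv ℝ η X (Pi.single 0 (EuclideanSpace.single l 1))) (volume.restrict (cellN (m + 1) L)) :=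
    integrableOn_cellN ((Complex.continuous_ofReal.comp hJ.continuous).mul
      ((hη.continuous_fderiv one_ne_zero).clm_apply continuous_const)) L
  rw [integral_add hi1 hi2] at hIBP
  linear_combination hIBP

/-! ### The registered stub -/

/-- **Registered stub `stub_flatFlowDiv` — WEAK DIVERGENCE OF THE FLATTENING FLOW.** [folklore] -/
theorem stub_flatFlowDiv : Goal.stub_flatFlowDiv := by
  intro m L hL Φ hz η hη hper
  have hL0 : L ≠ 0 := hL.ne'
  -- the three integrands
  have hg := contDiff_gDens hL Φ hz
  have hg1 := contDiff_gAvg1 hL Φ hz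
  have hg2 := contDiff_gAvg2 hL Φ hz
  have hf0 : ContDiff ℝ 1 (fluct (L ^ 3)⁻¹ L 0 (gAvg2 L Φ)) := contDiff_fluct _ L 0 hg2
  have hf1 : ContDiff ℝ 1 (fluct (L ^ 3)⁻¹ L 1 (gAvg1 L Φ)) := contDiff_fluct _ L 1 hg1
  have hf2 : ContDiff ℝ 1 (fluct (L ^ 3)⁻¹ L 2 (gDens L Φ)) := contDiff_fluct _ L 2 hg
  have hp0 := fluct_periodic (L ^ 3)⁻¹ L 0 (gAvg2_periodic L Φ)
  have hp1 := fluct_periodic (L ^ 3)⁻¹ L 1 (gAvg1_periodic L Φ)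
  have hp2 := fluct_periodic (L ^ 3)⁻¹ L 2 (gDens_periodic L Φ)
  have ha0 := intervalIntegral_fluct (m := m) hL0 (L ^ 3)⁻¹ 0 hg2.continuous
  have ha1 := intervalIntegral_fluct (m := m) hL0 (L ^ 3)⁻¹ 1 hg1.continuous
  have ha2 := intervalIntegral_fluct (m := m) hL0 (L ^ 3)⁻¹ 2 hg.continuous
  have e0 := integral_linePrim_mul_fderiv hL 0 hf0 hp0 ha0 hη hper
  have e1 := integral_linePrim_mul_fderiv hL 1 hf1 hp1 ha1 hη hper
  have e2 := integral_linePrim_mul_fderiv hL 2 hf2 hp2 ha2 hη hper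
  -- integrability of the three pairings
  have hint : ∀ (l : Fin 3) {f : Config (m + 1) → ℝ}, ContDiff ℝ 1 f →
      Integrable (fun X => ((linePrim l f X : ℝ) : ℂ) *
        fderiv ℝ η X (Pi.single 0 (EuclideanSpace.single l 1))) (volume.restrict (cellN (m + 1) L)) :=
    fun l f hf => integrableOn_cellN ((Complex.continuous_ofReal.comp (contDiff_linePrim l hf).continuous).mul
      ((hη.continuous_fderiv one_ne_zero).clm_apply continuous_const)) L
  have hintf : ∀ {f : Config (m + 1) → ℝ}, ContDiff ℝ 1 f →
      Integrable (fun X => ((f X : ℝ) : ℂ) * η X) (volume.restrict (cellN (m + 1) L)) :=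
    fun hf => integrableOn_cellN ((Complex.continuous_ofReal.comp hf.continuous).mul hη.continuous) L
  -- expand the sum over the three axes
  have hsum : ∀ X : Config (m + 1), ∑ l : Fin 3, flatFlow L Φ X l *
      fderiv ℝ η X (Pi.single 0 (EuclideanSpace.single l 1)) =
      ((linePrim 0 (fluct (L ^ 3)⁻¹ L 0 (gAvg2 L Φ)) X : ℝ) : ℂ) *
          fderiv ℝ η X (Pi.single 0 (EuclideanSpace.single 0 1)) +
        ((linePrim 1 (fluct (L ^ 3)⁻¹ L 1 (gAvg1 L Φ)) X : ℝ) : ℂ) *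
          fderiv ℝ η X (Pi.single 0 (EuclideanSpace.single 1 1)) +
        ((linePrim 2 (fluct (L ^ 3)⁻¹ L 2 (gDens L Φ)) X : ℝ) : ℂ) *
          fderiv ℝ η X (Pi.single 0 (EuclideanSpace.single 2 1)) := by
    intro X
    rw [Fin.sum_univ_three]
    rfl
  simp_rw [hsum]
  -- abbreviations for the three fluctuations
  set φ0 : Config (m + 1) → ℝ := fluct (L ^ 3)⁻¹ L 0 (gAvg2 L Φ) with hφ0
  set φ1 : Config (m + 1) → ℝ := fluct (L ^ 3)⁻¹ L 1 (gAvg1 L Φ) with hφ1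
  set φ2 : Config (m + 1) → ℝ := fluct (L ^ 3)⁻¹ L 2 (gDens L Φ) with hφ2
  -- split the left-hand side
  have hI01 : Integrable (fun X => ((linePrim 0 φ0 X : ℝ) : ℂ) *
        fderiv ℝ η X (Pi.single 0 (EuclideanSpace.single 0 1)) +
      ((linePrim 1 φ1 X : ℝ) : ℂ) * fderiv ℝ η X (Pi.single 0 (EuclideanSpace.single 1 1)))
      (volume.restrict (cellN (m + 1) L)) := (hint 0 hf0).add (hint 1 hf1)
  have step1 : ∫ X in cellN (m + 1) L, ((linePrim 0 φ0 X : ℝ) : ℂ) *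
        fderiv ℝ η X (Pi.single 0 (EuclideanSpace.single 0 1)) +
      ((linePrim 1 φ1 X : ℝ) : ℂ) * fderiv ℝ η X (Pi.single 0 (EuclideanSpace.single 1 1)) +
      ((linePrim 2 φ2 X : ℝ) : ℂ) * fderiv ℝ η X (Pi.single 0 (EuclideanSpace.single 2 1)) =
      (∫ X in cellN (m + 1) L, ((linePrim 0 φ0 X : ℝ) : ℂ) *
        fderiv ℝ η X (Pi.single 0 (EuclideanSpace.single 0 1)) +
      ((linePrim 1 φ1 X : ℝ) : ℂ) * fderiv ℝ η X (Pi.single 0 (EuclideanSpace.single 1 1))) +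
      ∫ X in cellN (m + 1) L, ((linePrim 2 φ2 X : ℝ) : ℂ) *
        fderiv ℝ η X (Pi.single 0 (EuclideanSpace.single 2 1)) := integral_add hI01 (hint 2 hf2)
  have step2 : ∫ X in cellN (m + 1) L, ((linePrim 0 φ0 X : ℝ) : ℂ) *
        fderiv ℝ η X (Pi.single 0 (EuclideanSpace.single 0 1)) +
      ((linePrim 1 φ1 X : ℝ) : ℂ) * fderiv ℝ η X (Pi.single 0 (EuclideanSpace.single 1 1)) =
      (∫ X in cellN (m + 1) L, ((linePrim 0 φ0 X : ℝ) : ℂ) *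
        fderiv ℝ η X (Pi.single 0 (EuclideanSpace.single 0 1))) +
      ∫ X in cellN (m + 1) L, ((linePrim 1 φ1 X : ℝ) : ℂ) *
        fderiv ℝ η X (Pi.single 0 (EuclideanSpace.single 1 1)) := integral_add (hint 0 hf0) (hint 1 hf1)
  rw [step1, step2, e0, e1, e2]
  -- assemble the right-hand side
  have htel : ∀ X : Config (m + 1), φ0 X + φ1 X + φ2 X = fibrePsi Φ X ^ 2 - (L ^ 3)⁻¹ * gAvg3 L Φ X := by
    intro X
    simp only [hφ0, hφ1, hφ2, fluct, gAvg3, gAvg2, gAvg1, gDens]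
    field_simp
    ring
  have hJ01 : Integrable (fun X => ((φ0 X : ℝ) : ℂ) * η X + ((φ1 X : ℝ) : ℂ) * η X)
      (volume.restrict (cellN (m + 1) L)) := (hintf hf0).add (hintf hf1)
  have step3 : ∫ X in cellN (m + 1) L, ((fibrePsi Φ X ^ 2 - (L ^ 3)⁻¹ * gAvg3 L Φ X : ℝ) : ℂ) * η X =
      ∫ X in cellN (m + 1) L, (((φ0 X : ℝ) : ℂ) * η X + ((φ1 X : ℝ) : ℂ) * η X) + ((φ2 X : ℝ) : ℂ) * η X := by
    refine integral_congr_ae (Filter.Eventually.of_forall fun X => ?_)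
    simp only
    rw [← htel X]
    push_cast
    ring
  have step4 : ∫ X in cellN (m + 1) L, (((φ0 X : ℝ) : ℂ) * η X + ((φ1 X : ℝ) : ℂ) * η X) + ((φ2 X : ℝ) : ℂ) * η X =
      (∫ X in cellN (m + 1) L, ((φ0 X : ℝ) : ℂ) * η X + ((φ1 X : ℝ) : ℂ) * η X) +
        ∫ X in cellN (m + 1) L, ((φ2 X : ℝ) : ℂ) * η X := integral_add hJ01 (hintf hf2)
  have step5 : ∫ X in cellN (m + 1) L, ((φ0 X : ℝ) : ℂ) * η X + ((φ1 X : ℝ) : ℂ) * η X =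
      (∫ X in cellN (m + 1) L, ((φ0 X : ℝ) : ℂ) * η X) + ∫ X in cellN (m + 1) L, ((φ1 X : ℝ) : ℂ) * η X :=
    integral_add (hintf hf0) (hintf hf1)
  rw [step3, step4, step5]
  ring

end Summit.AtomisticToContinuum.BoseEinsteinCondensation.Cruxes.FibreConductance.ParsevalShellBootstrap

end
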